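import Literature.Computability.QuantumComplexity.HadamardGadgetCodes
import Literature.Computability.Complexity.ListFoldBricks
import Literature.Computability.Complexity.PlumbingBricks
import Literature.Computability.Complexity.FPStringBricks
import HarnessLib

/-!
# The Hadamard gadget, VI: gate codes as strings and the post-selection block size in `FP`

Topic `Literature/Computability/QuantumComplexity`; sequel of `HadamardGadgetCodes.lean`
(Bremner–Jozsa–Shepherd 2011, proof of Thm. 1; uniformity half). The two string functions to
which `PostBQPWith_subset_PostIQPWith` was reduced there read the description
`⟨bin n, ⟨1^m, encList (gate codes)⟩⟩` of `F.circ n`. This file supplies the string-level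
reading of Clifford+`T` gate codes (`HGadget.symF`: the symbol numeral; `HGadget.extraU`: the
number `extra g ∈ {0, 1, 2}` of self-allocated gadget variables, in unary) in the `FP` algebra of
`Complexity/` (`fstF`/`sndF`, `fanoutFn`, `iteFn`, `eqValFn`, `dropFn`), and the first of the two
functions: **the post-selection block size `n ↦ 1^{postLenAt (padCirc (F.circ n))}` is
polynomial-time** (`HGadget.postLen_polyTime`) for every uniform oracle-free `F`, by a fold
(`Brick.foldFn`) over the gate codes accumulating `1^{extra gₜ + 2N}` — `postLenAt = m + K₁ + 1`
with `K₁ = N + Σₜ (extra gₜ + 2N)` (`padKFrom_eq_sum`).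

## References

* M. J. Bremner, R. Jozsa, D. J. Shepherd, Proc. R. Soc. A 467 (2011) 459–472, arXiv:1005.1407,
  Thm. 1 (proof), p. 7.
* S. Arora, B. Barak, *Computational Complexity: A Modern Approach*, CUP 2009, §1.3 (closure of
  polynomial time under composition and bounded loops), §6.2, Remark 6.7.
-/

noncomputable section

namespace Literature.Computability.QuantumComplexity

open _root_.Computability Complexity Cryptography Brick

namespace HGadget

variable {N : ℕ}

/-! ### Arithmetic of the counters -/

/-- The counter of the slots in closed form: `padKFrom N k gs = k + Σ_g (extra g + 2N)`. [folklore] -/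
theorem padKFrom_eq_sum (N k : ℕ) (gs : List (QGate cliffordT N)) :
    padKFrom N k gs = k + (gs.map fun g => extra g + N + N).sum := by
  induction gs generalizing k with
  | nil => simp [padKFrom]
  | cons g gs ih => rw [padKFrom, ih]; simp; omega

/-! ### Gate codes as strings -/

/-- The symbol index of a placed Clifford+`T` gate: `H = 0`, `S = 1`, `T = 2`, `CNOT = 3`
(`Encodable.encode`). [folklore] -/
def symIdx : QGate cliffordT N → ℕ
  | .gate .H _ => 0
  | .gate .S _ => 1
  | .gate .T _ => 2
  | .gate .CNOT _ => 3
  | .oracle k _ => k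

/-- The wire list of a placed gate, as numbers. [folklore] -/
def wireList : QGate cliffordT N → List ℕ
  | .gate _ e => List.ofFn fun i => (e i : ℕ)
  | .oracle _ e => List.ofFn fun i => (e i : ℕ)

/-- The tag bit of a gate code (`false` for gate symbols). [folklore] -/
def tagBit : QGate cliffordT N → Bool
  | .gate _ _ => false
  | .oracle _ _ => true

/-- **The shape of a Clifford+`T` gate code**: tag bit, then `⟨bin (symbol), wires code⟩`.
[cite: AroraBarak2009, §6.1] -/
theorem encode_eq_tag_cons (g : QGate cliffordT N) :
    g.encode = tagBit g :: boolPair (encodeNat (symIdx g)) (encodingListNatBool.encode (wireList g)) := by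
  cases g with
  | gate g e => cases g <;> rfl
  | oracle k e => rfl

/-- **The symbol numeral of a gate code**: drop the tag bit, then the first pair component
(`fstF ∘ dropFn ∘ ⟨1, ·⟩`, as in `CliffordTInverseCodeFP.symF`). [folklore] -/
def symF : List Bool → List Bool := fstF ∘ Plumb.dropFn ∘ fanoutFn (fun _ => [true]) id

/-- `symF ∈ FP`. [folklore] -/
theorem symF_mem_FP : symF ∈ FP :=
  comp_mem_FP fstF_mem_FP (comp_mem_FP Plumb.dropFn_mem_FP
    (fanoutFn_mem_FP (const_mem_FP _) (PolyTimeComputable.id _)))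

/-- `symF` of a gate code is the symbol numeral. [folklore] -/
theorem symF_encode (g : QGate cliffordT N) : symF g.encode = encodeNat (symIdx g) := by
  rw [encode_eq_tag_cons]
  simp [symF]

/-- `symF` does not lengthen. [folklore] -/
theorem length_symF_le (a : List Bool) : (symF a).length ≤ a.length := by
  simp only [symF, Function.comp_apply, fanoutFn_apply, Plumb.dropFn_boolPair, id, List.length_singleton]
  have h := length_fstF_sndF_le (a.drop 1)
  have h' : (a.drop 1).length ≤ a.length := by simp
  omega

/-- The test "symbol numeral has value `v`". [folklore] -/
def symIsF (v : ℕ) : List Bool → List Bool := eqValFn ∘ fanoutFn symF (fun _ => encodeNat v)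

/-- `symIsF v ∈ FP`. [folklore] -/
theorem symIsF_mem_FP (v : ℕ) : symIsF v ∈ FP :=
  comp_mem_FP eqValFn_mem_FP (fanoutFn_mem_FP symF_mem_FP (const_mem_FP _))

/-- `symIsF v` is one-bit. [folklore] -/
theorem oneBit_symIsF (v : ℕ) : OneBit (symIsF v) := oneBit_eqValFn.comp _

/-- `symIsF v` on a gate code. [folklore] -/
theorem symIsF_encode (v : ℕ) (g : QGate cliffordT N) : symIsF v g.encode = [decide (symIdx g = v)] := by
  simp [symIsF, symF_encode]

/-- **`extraU`: the number of self-allocated gadget variables of the coded gate, in unary**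
(`1` for `H`, `11` for `CNOT`, `ε` otherwise). [cite: BremnerJozsaShepherdPRSA2011, Thm. 1 (proof)] -/
def extraU : List Bool → List Bool :=
  iteFn (symIsF 0) (fun _ => [true]) (iteFn (symIsF 3) (fun _ => [true, true]) fun _ => [])

/-- `extraU ∈ FP`. [folklore] -/
theorem extraU_mem_FP : extraU ∈ FP :=
  iteFn_mem_FP (symIsF_mem_FP 0) (const_mem_FP _) (iteFn_mem_FP (symIsF_mem_FP 3) (const_mem_FP _) (const_mem_FP _))

/-- `extraU` has at most two symbols on every input. [folklore] -/
theorem length_extraU_le (a : List Bool) : (extraU a).length ≤ 2 := by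
  rw [extraU, iteFn_of_oneBit (oneBit_symIsF 0)]
  split_ifs
  · simp
  · rw [iteFn_of_oneBit (oneBit_symIsF 3)]; split_ifs <;> simp

/-- **`extraU` on the code of a gate symbol is `1^{extra g}`.** [folklore] -/
theorem extraU_encode_gate (g : CliffordTOp) (e : Fin (cliffordT.arity g) ↪ Fin N) :
    extraU (QGate.gate g e : QGate cliffordT N).encode = List.replicate (extra (QGate.gate g e : QGate cliffordT N)) true := by
  rw [extraU, iteFn_of_oneBit (oneBit_symIsF 0), symIsF_encode]
  cases g with
  | H => simp [symIdx, extra]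
  | S =>
    rw [if_neg (by simp [symIdx]), iteFn_of_oneBit (oneBit_symIsF 3), symIsF_encode]
    simp [symIdx, extra]
  | T =>
    rw [if_neg (by simp [symIdx]), iteFn_of_oneBit (oneBit_symIsF 3), symIsF_encode]
    simp [symIdx, extra]
  | CNOT =>
    rw [if_neg (by simp [symIdx]), iteFn_of_oneBit (oneBit_symIsF 3), symIsF_encode]
    simp [symIdx, extra]

/-! ### The fold computing `Σₜ (extra gₜ + 2N)` in unary -/

/-- One round of the sum: on `⟨u, ⟨a, acc⟩⟩` with `u = ⟨1^N, codes⟩`, append `extraU a` and twice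
`1^N` to the accumulator. [folklore] -/
def sumStep : List Bool → List Bool :=
  fun v => sndF (sndF v) ++ (extraU (fstF (sndF v)) ++ (fstF (fstF v) ++ fstF (fstF v)))

/-- `sumStep ∈ FP`. [folklore] -/
theorem sumStep_mem_FP : sumStep ∈ FP :=
  append_mem_FP (comp_mem_FP sndF_mem_FP sndF_mem_FP)
    (append_mem_FP (comp_mem_FP extraU_mem_FP (comp_mem_FP fstF_mem_FP sndF_mem_FP))
      (append_mem_FP (comp_mem_FP fstF_mem_FP fstF_mem_FP) (comp_mem_FP fstF_mem_FP fstF_mem_FP)))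

/-- Growth of `sumStep`: `|acc| + 2 + 2|u|`. [folklore] -/
theorem foldGrowth_sumStep : FoldGrowth 2 sumStep := by
  intro v
  simp only [sumStep, List.length_append]
  have h1 := length_extraU_le (fstF (sndF v))
  have h2 := length_fstF_sndF_le (fstF v)
  nlinarith

/-- The fold. [folklore] -/
def sumFold : List Bool → List Bool := foldFn sumStep fun _ => []

/-- `sumFold ∈ FP`. [folklore] -/
theorem sumFold_mem_FP : sumFold ∈ FP := foldFn_mem_FP sumStep_mem_FP (const_mem_FP _) foldGrowth_sumStep

/-- The rounds of the fold, for a context whose first field is `1^N`. [folklore] -/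
theorem foldl_sumStep (ctx : List Bool) (hctx : fstF ctx = List.replicate N true)
    (gs : List (QGate cliffordT N)) (hgs : ∀ g ∈ gs, g.IsOracleFree) (acc : List Bool) :
    (gs.map QGate.encode).foldl (fun acc a => sumStep (boolPair ctx (boolPair a acc))) acc =
      acc ++ List.replicate ((gs.map fun g => extra g + N + N).sum) true := by
  induction gs generalizing acc with
  | nil => simp
  | cons g gs ih =>
    have hg : g.IsOracleFree := hgs g (by simp)
    obtain ⟨g', e, rfl⟩ : ∃ g' e, g = QGate.gate g' e := by
      cases g with
      | gate g' e => exact ⟨g', e, rfl⟩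
      | oracle k e => exact absurd hg id
    rw [List.map_cons, List.foldl_cons, ih (fun g hg => hgs g (by simp [hg]))]
    simp only [sumStep, fstF_boolPair, sndF_boolPair, hctx, extraU_encode_gate, List.map_cons,
      List.sum_cons, List.append_assoc, ← List.replicate_add]
    congr 2
    omega

/-- **Value of the fold on `⟨1^N, encList (codes of oracle-free gates)⟩`**: the unary numeral of
`Σₜ (extra gₜ + 2N)`. [folklore] -/
theorem sumFold_apply (N : ℕ) (gs : List (QGate cliffordT N)) (hgs : ∀ g ∈ gs, g.IsOracleFree) :
    sumFold (boolPair (List.replicate N true) (encList (gs.map QGate.encode))) =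
      List.replicate ((gs.map fun g => extra g + N + N).sum) true := by
  rw [sumFold, foldFn_boolPair, decNil_encList, foldl_sumStep _ (fstF_boolPair _ _) gs hgs]
  simp

/-! ### The block size in unary -/

section PostLen

variable (F : QCircuitFamily cliffordT)

/-- `1^N = 1^{|w|} ++ 1^m` read off the input `w` (of length `n`) and the description of
`F.circ n` (`1^m` is its second field). [folklore] -/
def onesNF : List Bool → List Bool := fun w => onesFn w ++ fstF (sndF (F.descFn w))

/-- **The post-selection block size as a string function**:
`w ↦ 1^m ++ (1^N ++ Σ-fold ⟨1^N, codes⟩) ++ 1`, of value `1^{m + K₁ + 1}`.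
[cite: BremnerJozsaShepherdPRSA2011, Thm. 1 (proof)] -/
def postLenStr : List Bool → List Bool := fun w =>
  fstF (sndF (F.descFn w)) ++ ((onesNF F w ++ sumFold (boolPair (onesNF F w) (sndF (sndF (F.descFn w))))) ++ [true])

variable {F}

/-- `onesNF ∈ FP` for uniform `F`. [folklore] -/
theorem onesNF_mem_FP (hU : F.IsUniform) : onesNF F ∈ FP :=
  append_mem_FP onesFn_mem_FP (comp_mem_FP fstF_mem_FP (comp_mem_FP sndF_mem_FP
    (QCircuitFamily.descFn_mem_FP_of_isUniform hU)))

/-- `postLenStr ∈ FP` for uniform `F`. [cite: AroraBarak2009, §1.3] -/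
theorem postLenStr_mem_FP (hU : F.IsUniform) : postLenStr F ∈ FP := by
  have hd := QCircuitFamily.descFn_mem_FP_of_isUniform hU
  refine append_mem_FP (comp_mem_FP fstF_mem_FP (comp_mem_FP sndF_mem_FP hd))
    (append_mem_FP (append_mem_FP (onesNF_mem_FP hU) (comp_mem_FP sumFold_mem_FP ?_)) (const_mem_FP _))
  have h : (fun w => boolPair (onesNF F w) (sndF (sndF (F.descFn w)))) =
      fanoutFn (onesNF F) (sndF ∘ sndF ∘ F.descFn) := by
    funext w; simp [fanoutFn_apply]
  rw [h]
  exact fanoutFn_mem_FP (onesNF_mem_FP hU) (comp_mem_FP sndF_mem_FP (comp_mem_FP sndF_mem_FP hd))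

/-- **Value of `postLenStr`**: on any input of length `n`, `1^{postLenAt (padCirc (F.circ n))}`.
[cite: BremnerJozsaShepherdPRSA2011, Thm. 1 (proof)] -/
theorem postLenStr_apply (hF : F.IsOracleFree) (w : List Bool) :
    postLenStr F w = List.replicate (postLenAt (padCirc (F.circ w.length))) true := by
  have hdesc := QCircuitFamily.descFn_eq F w
  rw [QCircuit.encode_eq_encList] at hdesc
  have hm : fstF (sndF (F.descFn w)) = List.replicate (F.ancillas w.length) true := by
    rw [hdesc]; simp [OracleCompose.unaryEncodeNat_eq_replicate]
  have hN : onesNF F w = List.replicate (w.length + F.ancillas w.length) true := by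
    rw [onesNF, hm, onesFn, OracleCompose.unaryEncodeNat_eq_replicate, ← List.replicate_add]
  have hL : sndF (sndF (F.descFn w)) = encList ((F.circ w.length).gates.map QGate.encode) := by
    rw [hdesc]; simp
  rw [postLenStr, hm, hN, hL, sumFold_apply _ _ (hF w.length), postLenAt, preCount_padCirc,
    padKFrom_eq_sum, ← List.replicate_add, ← List.replicate_succ', ← List.replicate_add]
  congr 1

/-- **The post-selection block size of the padded gadget family is polynomial-time in unary**
(second hypothesis of `isUniform_gadgetFamily_padFamily_of`).
[cite: AroraBarak2009, §6.2 (P-uniform families), Remark 6.7] -/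
theorem postLen_polyTime (hF : F.IsOracleFree) (hU : F.IsUniform) :
    PolyTimeComputable unaryEncodeNat unaryEncodeNat fun n => postLenAt (padCirc (F.circ n)) := by
  refine PolyTimeComputable.of_encode (postLenStr_mem_FP hU) unaryEncodeNat (fun _ => rfl) fun n => ?_
  show postLenStr F (unaryEncodeNat n) = unaryEncodeNat (postLenAt (padCirc (F.circ n)))
  have hn : (unaryEncodeNat n).length = n := by rw [OracleCompose.unaryEncodeNat_eq_replicate, List.length_replicate]
  rw [postLenStr_apply hF, hn, OracleCompose.unaryEncodeNat_eq_replicate]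

end PostLen

end HGadget

end Literature.Computability.QuantumComplexity
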